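import Literature.AlgebraicGeometry.Motives.HodgeThetaSubalgebraRealPlacesSl2
import Literature.RepresentationTheory.GeneralLinear.PositionwiseWordOperators
import HarnessLib

/-!
# The rational Lie algebra of a rational tensor inside `𝔰𝔭_E(V, ψ)` contains `Θ` after complexification; rational tensors killed by `Θ` are killed by `⊕_i 𝔰𝔩(T_{σ_i})` (Deligne LNM 900 I §3; Ribet 1983 / Hazama 1983, Lie step)

Family `hodge`, layer `Literature/AlgebraicGeometry/Motives` (abstract polarizable `ℚ`-Hodge structures;
no geometry). Research context: cell `pub-hodge-ring2` (HONEST FRAMING: research route conditional on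
HC_CM; not a corollary; Q11.4-sentence-2 already refuted in dim ≥ 3), Literature lane, real-multiplication
programme R2, step R2b-ii ("Lie-to-cycles"), abstract half. This file is UNCONDITIONAL and no step
towards a summit statement.

SETTING (`HodgeThetaSubalgebraRealPlacesSl2`). `H` a polarizable `ℚ`-Hodge structure of odd weight `n`
on `V` with polarization `ψ` for which `E = End_Hdg(V)` is `ψ`-self-adjoint; `V_ℂ = ⊕_i T_{σ_i}` an
internal decomposition into two-dimensional eigenblocks for real characters `σ_i : E → ℂ` (an abelian
variety with real multiplication by a totally real field of degree `dim`: Ribet 1983 Thm. 0–1, Hazama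
1983 type (1) with `s = 1`). Tensors are handled in the tree's word model: a coefficient tensor is a
function `q` on words in the letters `Fin m × Fin M` (slot, index of a basis `eQ` of `V`), an operator
acts slice by slice (`wordSlice q u`, `u` a slot word) through the position-dependent differential
`wordDerAt` of its matrix (`RepresentationTheory/GeneralLinear/PositionwiseWordOperators`).

MAIN RESULT (`HodgeStructure.wordDerAt_eq_zero_of_mapsTo_of_skew`, THEOREM L). If a RATIONAL
coefficient tensor `q` is killed by (the matrix in `1 ⊗ eQ` of) a Hodge operator `Θ` (`= 2p - n` on
`V^{p,n-p}`), then it is killed by the matrix of EVERY block-preserving `ψ_ℂ`-skew operator of `V_ℂ`,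
i.e. by all of `⊕_i 𝔰𝔩(T_{σ_i}) = 𝔰𝔭_E(V, ψ)_ℂ`. PROOF (Deligne, LNM 900 I §3, proof of Prop. 3.4: the
Lie algebra of the `ℚ`-group fixing a rational tensor is defined over `ℚ` and contains the image of
`Θ`; here without algebraic groups): the rational endomorphisms `X ∈ 𝔰𝔭_E(V, ψ)` killing `q` form a
rational Lie algebra `𝔞` (§3 `annLie`: an intersection of kernels of rational linear functionals —
annihilation, `E`-linearity, `ψ`-skewness — closed under brackets); `Θ` satisfies the complexified
conditions, so `Θ ∈ 𝔞_ℂ` by DESCENT (§0: an operator killed by complex-linear conditions extending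
rational ones lies in the complex span of the rational solution space); hence `𝔞_ℂ = 𝔰𝔭_E(V, ψ)_ℂ`
by the tree's `Θ`-subalgebra theorem `HodgeStructure.ThetaSubalgebra.mem_spanC_of_mapsTo_of_skew`
(Hazama's §3 argument for an arbitrary rational Lie subalgebra containing `Θ` after complexification),
and `𝔞_ℂ` kills `q`. The geometric instantiation (abelian varieties with real multiplication, their
powers, Ribet's Thm. 0 `B•(Aⁿ) = D•(Aⁿ)`) is the sequel `HodgeTheory/RealMultiplicationPowersLieInvariance`.

CONTENTS (all proved; no named fact, D-0026):
* §0 `HodgeStructure.mem_spanC_iInf_ker_of_forall_eq_zero` — descent for solutions of rational linear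
  conditions (Deligne LNM 900 I §3).
* §1 `HodgeStructure.formBaseChange_assemble_add_eq_zero` — for ANY block bases, the block-diagonal
  operator on slotwise trace-free `2 × 2` matrices is `ψ_ℂ`-skew (`𝔰𝔭₂ = 𝔰𝔩₂` blockwise; Hazama §3).
* §2 `HodgeStructure.exists_hodgeAdapted_blockBasis` — in weight one, block bases `(b_i 0, b_i 1)` with
  `b_i 0 ∈ V^{1,0}`, `b_i 1 ∈ V^{0,1}` (from `Θ ∈ Lie Hdg ⊗ ℂ` preserving the blocks, complex
  conjugation for real characters, effectivity).
* §3 `HodgeStructure.annLie`, `mem_annLie_iff`, `commutator_mem_annLie`, `mem_spanC_annLie` (`Θ ∈ 𝔞_ℂ`),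
  `wordDerAt_eq_zero_of_mem_spanC_annLie`, and THEOREM L `wordDerAt_eq_zero_of_mapsTo_of_skew`.

## References

* [Deligne1982HodgeCycles] P. Deligne, *Hodge cycles on abelian varieties*, LNM 900 (1982), I §3
  (proof of Prop. 3.4), §4 p. 30. [cite: Deligne1982HodgeCycles, I §3 Prop. 3.4]
* [Ribet1983] K. A. Ribet, *Hodge classes on certain types of abelian varieties*, Amer. J. Math. 105
  (1983) 523–538, Thm. 0–1. [cite: Ribet1983, Thm. 0–1]
* [Hazama1983] F. Hazama, Tôhoku Math. J. 35 (1983) 303–308 (held `paper:doi-10-2748-tmj-1178229056`),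
  Thm. (1.1), §3 pp. 305–306. [cite: Hazama1983, Thm. (1.1) and §3 (pp. 305–306)]
* [MoonenZarhin1999LowDim] B. Moonen, Yu. Zarhin, Math. Ann. 315 (1999), §2 (2.1), §3 (3.1).
  [cite: MoonenZarhin1999LowDim, §2 (2.1) and §3 (3.1)]
* [DeligneHodgeII1971] P. Deligne, *Théorie de Hodge II*, Publ. IHÉS 40 (1971), 2.1.4. [cite: DeligneHodgeII1971, 2.1.4]
* [GoodmanWallachGTM255] R. Goodman, N. R. Wallach, GTM 255 (2009), §4.1.1. [cite: GoodmanWallachGTM255, §4.1.1]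
-/

noncomputable section

open scoped TensorProduct
open CategoryTheory Module

namespace Literature.AlgebraicGeometry.Motives

namespace HodgeStructure

/-! ### §0 Descent: complex-linear conditions extending rational ones -/

section Descent

universe u

variable {V : Type u} [AddCommGroup V] [Module ℚ V] [Module.Finite ℚ V]

/-- **Descent for solutions of rational linear conditions.** Let `p_d : End_ℚ(V) → ℚ` be rational
linear functionals and `P_d : End_ℂ(V_ℂ) → ℂ` complex linear functionals with `P_d (X_ℂ) = p_d X`. A
`ℂ`-linear endomorphism `Y` of `V_ℂ` with `P_d Y = 0` for all `d` lies in the complex span of the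
rational solution space `⨅_d ker p_d` (through `κ : ℂ ⊗ End_ℚ(V) ≅ End_ℂ(V_ℂ)`: the coordinates of
`κ⁻¹ Y` in a `ℚ`-basis of `ℂ` are rational solutions, `mem_baseChange_iInf_ker`). Deligne, LNM 900 I §3:
the Lie algebra and the invariants of a `ℚ`-group are defined over `ℚ`. [cite: Deligne1982HodgeCycles, I §3 (proof of Prop. 3.4)] -/
theorem mem_spanC_iInf_ker_of_forall_eq_zero {δ : Type*} (p : δ → (Module.End ℚ V →ₗ[ℚ] ℚ))
    (P : δ → (Module.End ℂ (ℂ ⊗[ℚ] V) →ₗ[ℂ] ℂ))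
    (hP : ∀ d (X : Module.End ℚ V), P d (X.baseChange ℂ) = algebraMap ℚ ℂ (p d X))
    {Y : Module.End ℂ (ℂ ⊗[ℚ] V)} (hY : ∀ d, P d Y = 0) :
    Y ∈ spanC (⨅ d, LinearMap.ker (p d)) := by
  obtain ⟨ξ, rfl⟩ := exists_homBaseChange_eq Y
  -- the complexified rational conditions vanish on `ξ`
  have hker : ∀ d, (p d).baseChange ℂ ξ = 0 := by
    intro d
    -- compare the two `ℂ`-linear maps `rid ∘ (p d)_ℂ` and `P d ∘ κ` on pure tensors
    have hmaps : ∀ ζ : ℂ ⊗[ℚ] Module.End ℚ V,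
        (TensorProduct.AlgebraTensorModule.rid ℚ ℂ ℂ) ((p d).baseChange ℂ ζ) =
          P d (homBaseChange V V ζ) := by
      intro ζ
      induction ζ using TensorProduct.induction_on with
      | zero => simp
      | tmul c X =>
        rw [LinearMap.baseChange_tmul, TensorProduct.AlgebraTensorModule.rid_tmul, homBaseChange_tmul,
          map_smul, hP, smul_eq_mul, Algebra.smul_def, mul_comm]
      | add x y hx hy => rw [map_add, map_add, hx, hy, map_add, map_add]
    have h := hmaps ξ
    rw [hY d] at h
    exact (TensorProduct.AlgebraTensorModule.rid ℚ ℂ ℂ).map_eq_zero_iff.1 h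
  have hmem := mem_baseChange_iInf_ker p hker
  have h := map_mem_span_of_mem_baseChange (homBaseChange V V) _ hmem
  rw [spanC]
  refine Submodule.span_mono ?_ h
  rintro _ ⟨X, hX, rfl⟩
  exact ⟨X, hX, by simp only [homBaseChange_tmul, one_smul]⟩

end Descent

/-! ### §1 Block-diagonal operators with trace-free blocks are skew (`𝔰𝔭₂ = 𝔰𝔩₂` blockwise), for any block bases -/

section Skew

open RealPlaces

universe u

variable {V : Type u} [AddCommGroup V] [Module ℚ V] {n : ℤ}
variable {ι : Type*} [Fintype ι] [DecidableEq ι]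

/-- On one block: for `x, y ∈ T_k` and a family `N` with `tr N_k = 0`, `ψ_ℂ(assemble N x, y) +
ψ_ℂ(x, assemble N y) = 0` (expand in the block basis; `ψ_ℂ` is alternating on the block in odd weight,
so the four coefficients reduce to `± tr N_k · ψ_ℂ(b_k 0, b_k 1)`). [cite: Hazama1983, §3 (pp. 305–306)] -/
theorem formBaseChange_assemble_add_eq_zero_same (H : HodgeStructure V n) (hn : Odd n)
    (ψ : H.Polarization) (σ : ι → (H.endAlg →+* ℂ))
    (hint : DirectSum.IsInternal fun i => H.eigenBlock (σ i))
    (b : ∀ i, Module.Basis (Fin 2) ℂ (H.eigenBlock (σ i))) (N : ι → Matrix (Fin 2) (Fin 2) ℂ)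
    (hN : ∀ k, (N k).trace = 0) (k : ι) {x y : ℂ ⊗[ℚ] V} (hx : x ∈ H.eigenBlock (σ k))
    (hy : y ∈ H.eigenBlock (σ k)) :
    ψ.form.baseChange ℂ (assemble hint b N x) y + ψ.form.baseChange ℂ x (assemble hint b N y) = 0 := by
  -- `x` and `y` lie in the span of the block basis vectors
  have hspan : ∀ {z : ℂ ⊗[ℚ] V}, z ∈ H.eigenBlock (σ k) →
      z ∈ Submodule.span ℂ (Set.range fun a => (b k a : ℂ ⊗[ℚ] V)) := by
    intro z hz
    have hz' : z = ∑ a, (b k).repr ⟨z, hz⟩ a • (b k a : ℂ ⊗[ℚ] V) := by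
      conv_lhs => rw [show z = ((⟨z, hz⟩ : H.eigenBlock (σ k)) : ℂ ⊗[ℚ] V) from rfl,
        ← (b k).sum_repr ⟨z, hz⟩]
      simp only [Submodule.coe_sum, Submodule.coe_smul]
    rw [hz']
    exact Submodule.sum_mem _ fun a _ => Submodule.smul_mem _ _ (Submodule.subset_span ⟨a, rfl⟩)
  have h00 : ψ.form.baseChange ℂ (b k 0 : ℂ ⊗[ℚ] V) (b k 0) = 0 :=
    form_baseChange_self_eq_zero_of_odd H hn ψ _
  have h11 : ψ.form.baseChange ℂ (b k 1 : ℂ ⊗[ℚ] V) (b k 1) = 0 :=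
    form_baseChange_self_eq_zero_of_odd H hn ψ _
  have h10 : ψ.form.baseChange ℂ (b k 1 : ℂ ⊗[ℚ] V) (b k 0) =
      -ψ.form.baseChange ℂ (b k 0 : ℂ ⊗[ℚ] V) (b k 1) :=
    form_baseChange_swap_of_odd H hn ψ _ _
  have htr : N k 0 0 + N k 1 1 = 0 := by rw [← Matrix.trace_fin_two]; exact hN k
  -- the values of `ψ_ℂ(N b_a, b_c) + ψ_ℂ(b_a, N b_c)` on basis vectors
  have hbasic : ∀ a c : Fin 2,
      ψ.form.baseChange ℂ (assemble hint b N (b k a)) (b k c) +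
        ψ.form.baseChange ℂ (b k a : ℂ ⊗[ℚ] V) (assemble hint b N (b k c)) = 0 := by
    intro a c
    rw [assemble_apply_basis, assemble_apply_basis]
    fin_cases a <;> fin_cases c <;>
      simp only [Fin.sum_univ_two, Fin.zero_eta, Fin.isValue, Fin.mk_one, map_add, map_smul,
        LinearMap.add_apply, LinearMap.smul_apply, smul_eq_mul, h00, h11, h10]
    · ring
    · linear_combination (ψ.form.baseChange ℂ (b k 0 : ℂ ⊗[ℚ] V) (b k 1)) * htr
    · linear_combination (-ψ.form.baseChange ℂ (b k 0 : ℂ ⊗[ℚ] V) (b k 1)) * htr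
    · ring
  -- bilinear expansion: induction over the spans
  have key : ∀ x ∈ Submodule.span ℂ (Set.range fun a => (b k a : ℂ ⊗[ℚ] V)),
      ∀ y ∈ Submodule.span ℂ (Set.range fun a => (b k a : ℂ ⊗[ℚ] V)),
      ψ.form.baseChange ℂ (assemble hint b N x) y + ψ.form.baseChange ℂ x (assemble hint b N y) = 0 := by
    intro x hx
    induction hx using Submodule.span_induction with
    | mem z hz =>
      obtain ⟨a, rfl⟩ := hz
      intro y hy
      induction hy using Submodule.span_induction with
      | mem z' hz' =>
        obtain ⟨c, rfl⟩ := hz'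
        exact hbasic a c
      | zero => simp
      | add y y' _ _ hy hy' =>
        rw [map_add, map_add, map_add, add_add_add_comm, hy, hy', add_zero]
      | smul r y _ hy =>
        rw [map_smul, map_smul, map_smul, smul_eq_mul, smul_eq_mul, ← mul_add, hy, mul_zero]
    | zero => intro y _; simp
    | add x x' _ _ hx hx' =>
      intro y hy
      rw [map_add, map_add, LinearMap.add_apply, map_add, LinearMap.add_apply, add_add_add_comm,
        hx y hy, hx' y hy, add_zero]
    | smul r x _ hx =>
      intro y hy
      rw [map_smul, map_smul, LinearMap.smul_apply, map_smul, LinearMap.smul_apply, smul_eq_mul,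
        smul_eq_mul, ← mul_add, hx y hy, mul_zero]
  exact key x (hspan hx) y (hspan hy)

/-- **Block-diagonal operators with slotwise trace-free blocks are `ψ_ℂ`-skew**, for ANY bases of the
blocks: `ψ_ℂ(assemble N x, y) + ψ_ℂ(x, assemble N y) = 0` when every `N_k` has trace zero and every Hodge
endomorphism is `ψ`-self-adjoint (distinct blocks are `ψ_ℂ`-orthogonal,
`form_eq_zero_of_mem_eigenBlock_of_isAdjointPair`; on one block `𝔰𝔭(T_k, ψ_k) = 𝔰𝔩(T_k)`). Hazama 1983
§3: "`p_i(𝔥) = 𝔰𝔩₂`" with "the skew symmetric non-degenerate bilinear form on the `𝔥`-module `V`".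
[cite: Hazama1983, §3 (pp. 305–306)] [cite: MoonenZarhin1999LowDim, §3 (3.1)] -/
theorem formBaseChange_assemble_add_eq_zero (H : HodgeStructure V n) (hn : Odd n) (ψ : H.Polarization)
    (hself : ∀ a : H.endAlg,
      LinearMap.IsAdjointPair ψ.form ψ.form (a : Module.End ℚ V) (a : Module.End ℚ V))
    (σ : ι → (H.endAlg →+* ℂ)) (hint : DirectSum.IsInternal fun i => H.eigenBlock (σ i))
    (b : ∀ i, Module.Basis (Fin 2) ℂ (H.eigenBlock (σ i))) (N : ι → Matrix (Fin 2) (Fin 2) ℂ)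
    (hN : ∀ k, (N k).trace = 0) (x y : ℂ ⊗[ℚ] V) :
    ψ.form.baseChange ℂ (assemble hint b N x) y + ψ.form.baseChange ℂ x (assemble hint b N y) = 0 := by
  have hσ := injective_of_isInternal_eigenBlock H σ hint b
  have hx : x ∈ ⨆ i, H.eigenBlock (σ i) := by rw [hint.submodule_iSup_eq_top]; exact Submodule.mem_top
  have hy : y ∈ ⨆ i, H.eigenBlock (σ i) := by rw [hint.submodule_iSup_eq_top]; exact Submodule.mem_top
  induction hx using Submodule.iSup_induction' generalizing y with
  | mem i x hx =>
    induction hy using Submodule.iSup_induction' with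
    | mem k y hy =>
      by_cases hik : i = k
      · subst hik
        exact formBaseChange_assemble_add_eq_zero_same H hn ψ σ hint b N hN i hx hy
      · have hne : σ i ≠ σ k := fun h => hik (hσ h)
        rw [form_eq_zero_of_mem_eigenBlock_of_isAdjointPair H ψ hself hne (assemble_mapsTo hint b N i hx) hy,
          form_eq_zero_of_mem_eigenBlock_of_isAdjointPair H ψ hself hne hx (assemble_mapsTo hint b N k hy),
          add_zero]
    | zero => simp
    | add y y' _ _ hy hy' => rw [map_add, map_add, map_add, add_add_add_comm, hy, hy', add_zero]
  | zero => simp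
  | add x x' _ _ hx hx' =>
    rw [map_add, map_add, LinearMap.add_apply, map_add, LinearMap.add_apply, add_add_add_comm,
      hx y hy, hx' y hy, add_zero]

end Skew

/-! ### §2 Weight one: block bases adapted to the Hodge decomposition -/

section Adapted

universe u

variable {V : Type u} [AddCommGroup V] [Module ℚ V] [Module.Finite ℚ V] [HodgeTensorFacts.{u, u}]
  {n : ℤ}
variable {ι : Type*}

omit [Module.Finite ℚ V] [HodgeTensorFacts.{u, u}] in
/-- In an effective Hodge structure of weight one, `Θ v + v ∈ V^{1,0}` and `Θ v - v ∈ V^{0,1}` for every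
`v ∈ V_ℂ` and every Hodge operator `Θ` (`= 2p - 1` on `V^{p,1-p}`; only `p = 0, 1` occur).
[cite: DeligneHodgeII1971, 2.1.4] [cite: Deligne1982HodgeCycles, I §3] -/
theorem theta_add_self_mem_piece (H : HodgeStructure V n) (hn : n = 1) (heff : H.IsEffective)
    {Θ : Module.End ℂ (ℂ ⊗[ℚ] V)} (hΘ : ∀ p, ∀ x ∈ H.piece p (n - p), Θ x = ((2 * p - n : ℤ) : ℂ) • x)
    (v : ℂ ⊗[ℚ] V) : Θ v + v ∈ H.piece 1 (n - 1) ∧ Θ v - v ∈ H.piece 0 (n - 0) := by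
  subst hn
  have hv : v ∈ ⨆ p : ℤ, H.piece p (1 - p) := by rw [iSup_piece_eq_top_holds H]; exact Submodule.mem_top
  induction hv using Submodule.iSup_induction' with
  | mem p x hx =>
    by_cases hp1 : p = 1
    · subst hp1
      have h1 : ((2 * 1 - 1 : ℤ) : ℂ) = 1 := by norm_num
      rw [hΘ 1 x hx, h1, one_smul]
      exact ⟨Submodule.add_mem _ hx hx, by rw [sub_self]; exact Submodule.zero_mem _⟩
    by_cases hp0 : p = 0
    · subst hp0
      have h0 : ((2 * 0 - 1 : ℤ) : ℂ) = -1 := by norm_num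
      rw [hΘ 0 x hx, h0, neg_one_smul]
      exact ⟨by rw [neg_add_cancel]; exact Submodule.zero_mem _,
        Submodule.sub_mem _ (Submodule.neg_mem _ hx) hx⟩
    · -- the other pieces vanish by effectivity
      have hbot : H.piece p (1 - p) = ⊥ := by
        by_contra h
        have h' := heff p (1 - p) h
        omega
      rw [hbot, Submodule.mem_bot] at hx
      subst hx
      simp
  | zero => simp
  | add x y _ _ hx hy =>
    rw [map_add]
    refine ⟨?_, ?_⟩
    · have h := Submodule.add_mem _ hx.1 hy.1
      convert h using 1; abel
    · have h := Submodule.add_mem _ hx.2 hy.2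
      convert h using 1; abel

/-- **Weight one, real characters: block bases adapted to the Hodge decomposition.** If the blocks
`T_{σ_i}` of real characters `σ_i` of `End_Hdg(V)` are two-dimensional, each has a basis `(b_i 0, b_i 1)`
with `b_i 0 ∈ V^{1,0}` and `b_i 1 ∈ V^{0,1}`: a Hodge operator `Θ ∈ Lie Hdg ⊗ ℂ` preserves the block
(`apply_mem_eigenBlock_of_mem_hodgeLieC`), so `Θ v ± v` are vectors of the block of pure types, one of them
non-zero; its complex conjugate is a vector of the (conjugation-stable) block of the opposite type.
(Hazama 1983 §3: each `V_i` carries a Hodge structure with `dim V_i^{1,0} = dim V_i^{0,1} = 1`; van Geemen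
2008 §2: "each `V_σ` is a real Hodge structure".) [cite: Hazama1983, §3 (pp. 305–306)]
[cite: Deligne1982HodgeCycles, §4 p. 30] -/
theorem exists_hodgeAdapted_blockBasis (H : HodgeStructure V n) (hn : n = 1) (heff : H.IsEffective)
    (σ : ι → (H.endAlg →+* ℂ)) (hreal : ∀ i, (starRingEnd ℂ).comp (σ i) = σ i)
    (h2 : ∀ i, Module.finrank ℂ (H.eigenBlock (σ i)) = 2) :
    ∃ b : ∀ i, Module.Basis (Fin 2) ℂ (H.eigenBlock (σ i)),
      (∀ i, (b i 0 : ℂ ⊗[ℚ] V) ∈ H.piece 1 (n - 1)) ∧ (∀ i, (b i 1 : ℂ ⊗[ℚ] V) ∈ H.piece 0 (n - 0)) := by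
  classical
  have hplusminus := fun {Θ : Module.End ℂ (ℂ ⊗[ℚ] V)}
    (hΘ : ∀ p, ∀ x ∈ H.piece p (n - p), Θ x = ((2 * p - n : ℤ) : ℂ) • x) (v : ℂ ⊗[ℚ] V) =>
    theta_add_self_mem_piece H hn heff hΘ v
  subst hn
  obtain ⟨Θ, hΘ⟩ := exists_hodgeTheta H
  have hΘC : Θ ∈ H.hodgeLieC := H.mem_hodgeLieC_of_forall_piece hΘ
  -- the two pieces are disjoint
  have hdisj : Disjoint (H.piece 1 (1 - 1)) (H.piece 0 (1 - 0)) :=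
    (iSupIndep_piece_holds H).pairwiseDisjoint (by norm_num)
  -- conjugation swaps them
  have hconj10 : ∀ {x}, x ∈ H.piece 1 (1 - 1) → conj x ∈ H.piece 0 (1 - 0) := fun {x} hx => by
    have h := conj_mem_piece H hx
    simp only [sub_self, sub_zero] at h ⊢; exact h
  have hconj01 : ∀ {x}, x ∈ H.piece 0 (1 - 0) → conj x ∈ H.piece 1 (1 - 1) := fun {x} hx => by
    have h := conj_mem_piece H hx
    simp only [sub_self, sub_zero] at h ⊢; exact h
  have key : ∀ i, ∃ b : Module.Basis (Fin 2) ℂ (H.eigenBlock (σ i)),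
      (b 0 : ℂ ⊗[ℚ] V) ∈ H.piece 1 (1 - 1) ∧ (b 1 : ℂ ⊗[ℚ] V) ∈ H.piece 0 (1 - 0) := by
    intro i
    set T := H.eigenBlock (σ i) with hT
    haveI : Module.Finite ℂ T := Module.finite_of_finrank_eq_succ (h2 i)
    have hconjT : ∀ {x}, x ∈ T → conj x ∈ T := fun {x} hx => by
      have h := H.conj_mem_eigenBlock hx
      rwa [hreal i] at h
    -- a pair (x₀ ∈ T ∩ V^{1,0}, x₁ ∈ T ∩ V^{0,1}) of non-zero vectors
    obtain ⟨x₀, x₁, hx₀T, hx₁T, hx₀, hx₁, hx₀0, hx₁0⟩ : ∃ x₀ x₁ : ℂ ⊗[ℚ] V, x₀ ∈ T ∧ x₁ ∈ T ∧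
        x₀ ∈ H.piece 1 (1 - 1) ∧ x₁ ∈ H.piece 0 (1 - 0) ∧ x₀ ≠ 0 ∧ x₁ ≠ 0 := by
      obtain ⟨v, hvT, hv0⟩ : ∃ v : ℂ ⊗[ℚ] V, v ∈ T ∧ v ≠ 0 := by
        set b' := Module.finBasisOfFinrankEq ℂ T (h2 i)
        exact ⟨b' 0, (b' 0).2, fun h => b'.ne_zero 0 (Subtype.ext h)⟩
      have hΘv : Θ v ∈ T := H.apply_mem_eigenBlock_of_mem_hodgeLieC hΘC hvT
      obtain ⟨hplus, hminus⟩ := hplusminus hΘ v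
      by_cases hp : Θ v + v = 0
      · have hm : Θ v - v ≠ 0 := by
          intro hm
          apply hv0
          have h2v : (Θ v + v) - (Θ v - v) = 0 := by rw [hp, hm, sub_zero]
          have : (2 : ℂ) • v = 0 := by rw [two_smul]; convert h2v using 1; abel
          exact (smul_eq_zero.1 this).resolve_left two_ne_zero
        refine ⟨conj (Θ v - v), Θ v - v, hconjT (Submodule.sub_mem _ hΘv hvT),
          Submodule.sub_mem _ hΘv hvT, hconj01 hminus, hminus, ?_, hm⟩
        intro h
        exact hm (by rw [← conj_conj (Θ v - v), h, map_zero])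
      · refine ⟨Θ v + v, conj (Θ v + v), Submodule.add_mem _ hΘv hvT,
          hconjT (Submodule.add_mem _ hΘv hvT), hplus, hconj10 hplus, hp, ?_⟩
        intro h
        exact hp (by rw [← conj_conj (Θ v + v), h, map_zero])
    -- they are linearly independent, hence a basis of the two-dimensional block
    have hli : LinearIndependent ℂ ![(⟨x₀, hx₀T⟩ : T), ⟨x₁, hx₁T⟩] := by
      rw [LinearIndependent.pair_iff]
      intro s t hst
      have hst' : s • x₀ + t • x₁ = 0 := by
        have := congrArg Subtype.val hst
        simpa using this
      have hsx : s • x₀ ∈ H.piece 1 (1 - 1) ⊓ H.piece 0 (1 - 0) := by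
        refine ⟨Submodule.smul_mem _ _ hx₀, ?_⟩
        have : s • x₀ = -(t • x₁) := eq_neg_of_add_eq_zero_left hst'
        rw [this]
        exact Submodule.neg_mem _ (Submodule.smul_mem _ _ hx₁)
      rw [hdisj.eq_bot, Submodule.mem_bot] at hsx
      have hs : s = 0 := (smul_eq_zero.1 hsx).resolve_right hx₀0
      rw [hs, zero_smul, zero_add] at hst'
      exact ⟨hs, (smul_eq_zero.1 hst').resolve_right hx₁0⟩
    refine ⟨basisOfLinearIndependentOfCardEqFinrank hli (by rw [Fintype.card_fin, h2 i]), ?_, ?_⟩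
    · rw [coe_basisOfLinearIndependentOfCardEqFinrank]; exact hx₀
    · rw [coe_basisOfLinearIndependentOfCardEqFinrank]; exact hx₁
  choose b hb0 hb1 using key
  exact ⟨b, hb0, hb1⟩

end Adapted

/-! ### §3 The rational Lie algebra of a rational coefficient tensor inside `𝔰𝔭_E(V, ψ)`; `Θ` lies in its complexification -/

section AnnLie

open Literature.RepresentationTheory.GeneralLinear Literature.NumberTheory.DiophantineGeometry

universe u

variable {V : Type u} [AddCommGroup V] [Module ℚ V]
variable {M d m : ℕ} {ιa : Type*}

/-- The rational linear condition "the matrix of `X` (in the basis `eQ`), placed at every position, kills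
the slice `q(u, −)` at the colour word `ε`" — the annihilator conditions of a rational coefficient tensor
`q` (letters: slots `Fin m` × alphabet `Fin M`). [cite: GoodmanWallachGTM255, §4.1.1]
[cite: MoonenZarhin1999LowDim, §3 (3.1)] -/
def annCond (eQ : Module.Basis (Fin M) ℚ V) (q : (Fin d → Fin m × Fin M) → ℚ)
    (uε : (Fin d → Fin m) × Word M d) : Module.End ℚ V →ₗ[ℚ] ℚ where
  toFun X := wordDerAt ℚ (fun _ : Fin d => LinearMap.toMatrix eQ eQ X) (wordSlice q uε.1) uε.2
  map_add' X Y := by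
    have h : (fun _ : Fin d => LinearMap.toMatrix eQ eQ (X + Y)) =
        (fun _ : Fin d => LinearMap.toMatrix eQ eQ X) + fun _ : Fin d => LinearMap.toMatrix eQ eQ Y := by
      funext t; rw [map_add]; rfl
    rw [h, wordDerAt_add]; rfl
  map_smul' r X := by
    have h : (fun _ : Fin d => LinearMap.toMatrix eQ eQ (r • X)) =
        r • fun _ : Fin d => LinearMap.toMatrix eQ eQ X := by
      funext t; rw [map_smul]; rfl
    rw [h, wordDerAt_smul]; rfl

/-- Unfolding `annCond`. [cite: GoodmanWallachGTM255, §4.1.1] -/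
theorem annCond_apply (eQ : Module.Basis (Fin M) ℚ V) (q : (Fin d → Fin m × Fin M) → ℚ)
    (uε : (Fin d → Fin m) × Word M d) (X : Module.End ℚ V) :
    annCond eQ q uε X = wordDerAt ℚ (fun _ : Fin d => LinearMap.toMatrix eQ eQ X) (wordSlice q uε.1) uε.2 :=
  rfl

/-- The complex counterpart of `annCond`: the matrix of `Y ∈ End_ℂ(V_ℂ)` in the complexified basis
`1 ⊗ eQ`, placed at every position, evaluated on a complex coefficient tensor `a`. [cite: GoodmanWallachGTM255, §4.1.1] -/
def annCondC (eQ : Module.Basis (Fin M) ℚ V) (a : (Fin d → Fin m × Fin M) → ℂ)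
    (uε : (Fin d → Fin m) × Word M d) : Module.End ℂ (ℂ ⊗[ℚ] V) →ₗ[ℂ] ℂ where
  toFun Y := wordDerAt ℂ (fun _ : Fin d =>
    LinearMap.toMatrix (Algebra.TensorProduct.basis ℂ eQ) (Algebra.TensorProduct.basis ℂ eQ) Y)
    (wordSlice a uε.1) uε.2
  map_add' X Y := by
    have h : (fun _ : Fin d => LinearMap.toMatrix (Algebra.TensorProduct.basis ℂ eQ)
        (Algebra.TensorProduct.basis ℂ eQ) (X + Y)) =
        (fun _ : Fin d => LinearMap.toMatrix (Algebra.TensorProduct.basis ℂ eQ)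
          (Algebra.TensorProduct.basis ℂ eQ) X) +
        fun _ : Fin d => LinearMap.toMatrix (Algebra.TensorProduct.basis ℂ eQ)
          (Algebra.TensorProduct.basis ℂ eQ) Y := by
      funext t; rw [map_add]; rfl
    rw [h, wordDerAt_add]; rfl
  map_smul' r X := by
    have h : (fun _ : Fin d => LinearMap.toMatrix (Algebra.TensorProduct.basis ℂ eQ)
        (Algebra.TensorProduct.basis ℂ eQ) (r • X)) =
        r • fun _ : Fin d => LinearMap.toMatrix (Algebra.TensorProduct.basis ℂ eQ)
          (Algebra.TensorProduct.basis ℂ eQ) X := by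
      funext t; rw [map_smul]; rfl
    rw [h, wordDerAt_smul]; rfl

/-- Unfolding `annCondC`. [cite: GoodmanWallachGTM255, §4.1.1] -/
theorem annCondC_apply (eQ : Module.Basis (Fin M) ℚ V) (a : (Fin d → Fin m × Fin M) → ℂ)
    (uε : (Fin d → Fin m) × Word M d) (Y : Module.End ℂ (ℂ ⊗[ℚ] V)) :
    annCondC eQ a uε Y = wordDerAt ℂ (fun _ : Fin d =>
      LinearMap.toMatrix (Algebra.TensorProduct.basis ℂ eQ) (Algebra.TensorProduct.basis ℂ eQ) Y)
      (wordSlice a uε.1) uε.2 :=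
  rfl

/-- Compatibility: on `X_ℂ` and the complexified tensor `q`, `annCondC` is `annCond` (the matrix of `X_ℂ`
in `1 ⊗ eQ` is the matrix of `X`, `LinearMap.toMatrix_baseChange`; `wordDerAt_map`).
[cite: GoodmanWallachGTM255, §4.1.1] -/
theorem annCondC_baseChange (eQ : Module.Basis (Fin M) ℚ V) (q : (Fin d → Fin m × Fin M) → ℚ)
    (uε : (Fin d → Fin m) × Word M d) (X : Module.End ℚ V) :
    annCondC eQ (fun w => algebraMap ℚ ℂ (q w)) uε (X.baseChange ℂ) = algebraMap ℚ ℂ (annCond eQ q uε X) := by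
  rw [annCondC_apply, annCond_apply, LinearMap.toMatrix_baseChange, ← wordDerAt_map ℚ (algebraMap ℚ ℂ)]
  rfl

/-- The rational linear condition "the `(r,s)` entry of the matrix of `[X, a]` vanishes" (`E`-linearity,
entrywise). [cite: Deligne1982HodgeCycles, I §3 (proof of Prop. 3.4)] -/
def commCond (eQ : Module.Basis (Fin M) ℚ V) (a : Module.End ℚ V) (rs : Fin M × Fin M) :
    Module.End ℚ V →ₗ[ℚ] ℚ where
  toFun X := LinearMap.toMatrix eQ eQ (X * a - a * X) rs.1 rs.2
  map_add' X Y := by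
    have h : (X + Y) * a - a * (X + Y) = (X * a - a * X) + (Y * a - a * Y) := by noncomm_ring
    change LinearMap.toMatrix eQ eQ ((X + Y) * a - a * (X + Y)) rs.1 rs.2 =
      LinearMap.toMatrix eQ eQ (X * a - a * X) rs.1 rs.2 + LinearMap.toMatrix eQ eQ (Y * a - a * Y) rs.1 rs.2
    rw [h, map_add, Matrix.add_apply]
  map_smul' r X := by
    have h : r • X * a - a * (r • X) = r • (X * a - a * X) := by
      rw [smul_sub, smul_mul_assoc]; congr 1; ext v; simp
    change LinearMap.toMatrix eQ eQ (r • X * a - a * (r • X)) rs.1 rs.2 =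
      r * LinearMap.toMatrix eQ eQ (X * a - a * X) rs.1 rs.2
    rw [h, map_smul, Matrix.smul_apply, smul_eq_mul]

/-- Unfolding `commCond`. [cite: Deligne1982HodgeCycles, I §3 (proof of Prop. 3.4)] -/
theorem commCond_apply (eQ : Module.Basis (Fin M) ℚ V) (a : Module.End ℚ V) (rs : Fin M × Fin M)
    (X : Module.End ℚ V) : commCond eQ a rs X = LinearMap.toMatrix eQ eQ (X * a - a * X) rs.1 rs.2 :=
  rfl

/-- The complex counterpart of `commCond`. [cite: Deligne1982HodgeCycles, I §3 (proof of Prop. 3.4)] -/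
def commCondC (eQ : Module.Basis (Fin M) ℚ V) (a : Module.End ℚ V) (rs : Fin M × Fin M) :
    Module.End ℂ (ℂ ⊗[ℚ] V) →ₗ[ℂ] ℂ where
  toFun Y := LinearMap.toMatrix (Algebra.TensorProduct.basis ℂ eQ) (Algebra.TensorProduct.basis ℂ eQ)
    (Y * a.baseChange ℂ - a.baseChange ℂ * Y) rs.1 rs.2
  map_add' X Y := by
    have h : (X + Y) * a.baseChange ℂ - a.baseChange ℂ * (X + Y) =
        (X * a.baseChange ℂ - a.baseChange ℂ * X) + (Y * a.baseChange ℂ - a.baseChange ℂ * Y) := by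
      noncomm_ring
    change LinearMap.toMatrix (Algebra.TensorProduct.basis ℂ eQ) (Algebra.TensorProduct.basis ℂ eQ)
        ((X + Y) * a.baseChange ℂ - a.baseChange ℂ * (X + Y)) rs.1 rs.2 =
      LinearMap.toMatrix (Algebra.TensorProduct.basis ℂ eQ) (Algebra.TensorProduct.basis ℂ eQ)
        (X * a.baseChange ℂ - a.baseChange ℂ * X) rs.1 rs.2 +
      LinearMap.toMatrix (Algebra.TensorProduct.basis ℂ eQ) (Algebra.TensorProduct.basis ℂ eQ)
        (Y * a.baseChange ℂ - a.baseChange ℂ * Y) rs.1 rs.2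
    rw [h, map_add, Matrix.add_apply]
  map_smul' r X := by
    have h : r • X * a.baseChange ℂ - a.baseChange ℂ * (r • X) = r • (X * a.baseChange ℂ - a.baseChange ℂ * X) := by
      rw [smul_sub, smul_mul_assoc]; congr 1; ext v; simp
    change LinearMap.toMatrix (Algebra.TensorProduct.basis ℂ eQ) (Algebra.TensorProduct.basis ℂ eQ)
        (r • X * a.baseChange ℂ - a.baseChange ℂ * (r • X)) rs.1 rs.2 =
      r * LinearMap.toMatrix (Algebra.TensorProduct.basis ℂ eQ) (Algebra.TensorProduct.basis ℂ eQ)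
        (X * a.baseChange ℂ - a.baseChange ℂ * X) rs.1 rs.2
    rw [h, map_smul, Matrix.smul_apply, smul_eq_mul]

/-- Unfolding `commCondC`. [cite: Deligne1982HodgeCycles, I §3 (proof of Prop. 3.4)] -/
theorem commCondC_apply (eQ : Module.Basis (Fin M) ℚ V) (a : Module.End ℚ V) (rs : Fin M × Fin M)
    (Y : Module.End ℂ (ℂ ⊗[ℚ] V)) : commCondC eQ a rs Y =
      LinearMap.toMatrix (Algebra.TensorProduct.basis ℂ eQ) (Algebra.TensorProduct.basis ℂ eQ)
        (Y * a.baseChange ℂ - a.baseChange ℂ * Y) rs.1 rs.2 :=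
  rfl

/-- Compatibility of `commCondC` with `commCond` on `X_ℂ`. [cite: Deligne1982HodgeCycles, I §3 (proof of Prop. 3.4)] -/
theorem commCondC_baseChange (eQ : Module.Basis (Fin M) ℚ V) (a : Module.End ℚ V) (rs : Fin M × Fin M)
    (X : Module.End ℚ V) : commCondC eQ a rs (X.baseChange ℂ) = algebraMap ℚ ℂ (commCond eQ a rs X) := by
  rw [commCondC_apply, commCond_apply, ← LinearMap.baseChange_mul, ← LinearMap.baseChange_mul,
    ← LinearMap.baseChange_sub, LinearMap.toMatrix_baseChange, Matrix.map_apply]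

/-- The rational linear condition "`ψ(X e_r, e_s) + ψ(e_r, X e_s) = 0`" (`ψ`-skewness on basis vectors).
[cite: Hazama1983, §3 (p. 305)] -/
def skewCond (φ : LinearMap.BilinForm ℚ V) (eQ : Module.Basis (Fin M) ℚ V) (rs : Fin M × Fin M) :
    Module.End ℚ V →ₗ[ℚ] ℚ where
  toFun X := φ (X (eQ rs.1)) (eQ rs.2) + φ (eQ rs.1) (X (eQ rs.2))
  map_add' X Y := by
    simp only [LinearMap.add_apply, map_add]; ring
  map_smul' r X := by
    simp only [LinearMap.smul_apply, map_smul, LinearMap.smul_apply, smul_eq_mul, RingHom.id_apply]; ring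

/-- Unfolding `skewCond`. [cite: Hazama1983, §3 (p. 305)] -/
theorem skewCond_apply (φ : LinearMap.BilinForm ℚ V) (eQ : Module.Basis (Fin M) ℚ V) (rs : Fin M × Fin M)
    (X : Module.End ℚ V) : skewCond φ eQ rs X = φ (X (eQ rs.1)) (eQ rs.2) + φ (eQ rs.1) (X (eQ rs.2)) :=
  rfl

/-- The complex counterpart of `skewCond`. [cite: Hazama1983, §3 (p. 305)] -/
def skewCondC (φ : LinearMap.BilinForm ℚ V) (eQ : Module.Basis (Fin M) ℚ V) (rs : Fin M × Fin M) :
    Module.End ℂ (ℂ ⊗[ℚ] V) →ₗ[ℂ] ℂ where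
  toFun Y := φ.baseChange ℂ (Y (Algebra.TensorProduct.basis ℂ eQ rs.1)) (Algebra.TensorProduct.basis ℂ eQ rs.2) +
    φ.baseChange ℂ (Algebra.TensorProduct.basis ℂ eQ rs.1) (Y (Algebra.TensorProduct.basis ℂ eQ rs.2))
  map_add' X Y := by
    simp only [LinearMap.add_apply, map_add]; ring
  map_smul' r X := by
    simp only [LinearMap.smul_apply, map_smul, LinearMap.smul_apply, smul_eq_mul, RingHom.id_apply]; ring

/-- Unfolding `skewCondC`. [cite: Hazama1983, §3 (p. 305)] -/
theorem skewCondC_apply (φ : LinearMap.BilinForm ℚ V) (eQ : Module.Basis (Fin M) ℚ V) (rs : Fin M × Fin M)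
    (Y : Module.End ℂ (ℂ ⊗[ℚ] V)) : skewCondC φ eQ rs Y =
      φ.baseChange ℂ (Y (Algebra.TensorProduct.basis ℂ eQ rs.1)) (Algebra.TensorProduct.basis ℂ eQ rs.2) +
      φ.baseChange ℂ (Algebra.TensorProduct.basis ℂ eQ rs.1) (Y (Algebra.TensorProduct.basis ℂ eQ rs.2)) :=
  rfl

/-- Compatibility of `skewCondC` with `skewCond` on `X_ℂ`. [cite: Hazama1983, §3 (p. 305)] -/
theorem skewCondC_baseChange (φ : LinearMap.BilinForm ℚ V) (eQ : Module.Basis (Fin M) ℚ V)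
    (rs : Fin M × Fin M) (X : Module.End ℚ V) :
    skewCondC φ eQ rs (X.baseChange ℂ) = algebraMap ℚ ℂ (skewCond φ eQ rs X) := by
  rw [skewCondC_apply, skewCond_apply, Algebra.TensorProduct.basis_apply, Algebra.TensorProduct.basis_apply,
    LinearMap.baseChange_tmul, LinearMap.baseChange_tmul, LinearMap.BilinForm.baseChange_tmul,
    LinearMap.BilinForm.baseChange_tmul, map_add]
  simp [Algebra.smul_def]

/-- The index of the three families of rational conditions. [folklore] -/
abbrev AnnIdx (ιa : Type*) (M d m : ℕ) : Type _ :=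
  ((Fin d → Fin m) × Word M d) ⊕ (ιa × (Fin M × Fin M)) ⊕ (Fin M × Fin M)

/-- The three families of rational conditions as one family. [cite: Deligne1982HodgeCycles, I §3 (proof of Prop. 3.4)] -/
def annFamily (φ : LinearMap.BilinForm ℚ V) (eQ : Module.Basis (Fin M) ℚ V) (aF : ιa → Module.End ℚ V)
    (q : (Fin d → Fin m × Fin M) → ℚ) : AnnIdx ιa M d m → (Module.End ℚ V →ₗ[ℚ] ℚ)
  | Sum.inl uε => annCond eQ q uε
  | Sum.inr (Sum.inl irs) => commCond eQ (aF irs.1) irs.2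
  | Sum.inr (Sum.inr rs) => skewCond φ eQ rs

/-- The three families of complex conditions as one family. [cite: Deligne1982HodgeCycles, I §3 (proof of Prop. 3.4)] -/
def annFamilyC (φ : LinearMap.BilinForm ℚ V) (eQ : Module.Basis (Fin M) ℚ V) (aF : ιa → Module.End ℚ V)
    (a : (Fin d → Fin m × Fin M) → ℂ) : AnnIdx ιa M d m → (Module.End ℂ (ℂ ⊗[ℚ] V) →ₗ[ℂ] ℂ)
  | Sum.inl uε => annCondC eQ a uε
  | Sum.inr (Sum.inl irs) => commCondC eQ (aF irs.1) irs.2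
  | Sum.inr (Sum.inr rs) => skewCondC φ eQ rs

/-- **The rational Lie algebra `𝔞 = 𝔞(q) ∩ 𝔰𝔭_E(V, ψ)` of a rational coefficient tensor**: the rational
endomorphisms `X` killing the tensor `q` (diagonally at all positions, in the basis `eQ`), commuting with
the family `aF` (generators of `E = End_Hdg`) and `ψ`-skew — as an intersection of kernels of rational
linear functionals. [cite: Deligne1982HodgeCycles, I §3 (proof of Prop. 3.4)] [cite: MoonenZarhin1999LowDim, §3 (3.1)] -/
def annLie (φ : LinearMap.BilinForm ℚ V) (eQ : Module.Basis (Fin M) ℚ V) (aF : ιa → Module.End ℚ V)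
    (q : (Fin d → Fin m × Fin M) → ℚ) : Submodule ℚ (Module.End ℚ V) :=
  ⨅ i, LinearMap.ker (annFamily φ eQ aF q i)

/-- Membership in `annLie`: the three families of conditions. [cite: Deligne1982HodgeCycles, I §3 (proof of Prop. 3.4)] -/
theorem mem_annLie_iff (φ : LinearMap.BilinForm ℚ V) (eQ : Module.Basis (Fin M) ℚ V)
    (aF : ιa → Module.End ℚ V) (q : (Fin d → Fin m × Fin M) → ℚ) (X : Module.End ℚ V) :
    X ∈ annLie φ eQ aF q ↔
      (∀ u : Fin d → Fin m, wordDerAt ℚ (fun _ : Fin d => LinearMap.toMatrix eQ eQ X) (wordSlice q u) = 0) ∧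
      (∀ i, X * aF i = aF i * X) ∧ (∀ v w, φ (X v) w + φ v (X w) = 0) := by
  simp only [annLie, Submodule.mem_iInf, LinearMap.mem_ker]
  constructor
  · intro h
    refine ⟨fun u => funext fun ε => h (Sum.inl (u, ε)), fun i => ?_, fun v w => ?_⟩
    · have hi : ∀ rs : Fin M × Fin M, LinearMap.toMatrix eQ eQ (X * aF i - aF i * X) rs.1 rs.2 = 0 :=
        fun rs => h (Sum.inr (Sum.inl (i, rs)))
      have hz : LinearMap.toMatrix eQ eQ (X * aF i - aF i * X) = 0 := Matrix.ext fun r s' => hi (r, s')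
      exact sub_eq_zero.1 ((LinearMap.toMatrix eQ eQ).map_eq_zero_iff.1 hz)
    · have hrs : ∀ rs : Fin M × Fin M, φ (X (eQ rs.1)) (eQ rs.2) + φ (eQ rs.1) (X (eQ rs.2)) = 0 :=
        fun rs => h (Sum.inr (Sum.inr rs))
      -- a bilinear form vanishing on pairs of basis vectors vanishes
      have hB : φ ∘ₗ X + φ.compl₂ X = 0 :=
        LinearMap.BilinForm.ext_basis eQ fun r s' => by
          simpa only [LinearMap.add_apply, LinearMap.comp_apply, LinearMap.compl₂_apply,
            LinearMap.zero_apply] using hrs (r, s')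
      have h0 := LinearMap.congr_fun (LinearMap.congr_fun hB v) w
      simpa only [LinearMap.add_apply, LinearMap.comp_apply, LinearMap.compl₂_apply,
        LinearMap.zero_apply] using h0
  · rintro ⟨h1, h2, h3⟩ i
    rcases i with uε | irs | rs
    · change wordDerAt ℚ (fun _ : Fin d => LinearMap.toMatrix eQ eQ X) (wordSlice q uε.1) uε.2 = 0
      rw [h1]; rfl
    · change LinearMap.toMatrix eQ eQ (X * aF irs.1 - aF irs.1 * X) irs.2.1 irs.2.2 = 0
      rw [h2, sub_self, map_zero]; rfl
    · exact h3 _ _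

/-- **`𝔞` is closed under the commutator.** (Annihilators of a tensor under a derivation action form a
Lie algebra, `wordDerAt_commutator_eq_zero`; operators commuting with `aF` and `ψ`-skew operators are
closed under brackets.) [cite: MoonenZarhin1999LowDim, §3 (3.1)] [cite: GoodmanWallachGTM255, §4.1.1] -/
theorem commutator_mem_annLie (φ : LinearMap.BilinForm ℚ V) (eQ : Module.Basis (Fin M) ℚ V)
    (aF : ιa → Module.End ℚ V) (q : (Fin d → Fin m × Fin M) → ℚ) {X Y : Module.End ℚ V}
    (hX : X ∈ annLie φ eQ aF q) (hY : Y ∈ annLie φ eQ aF q) : X * Y - Y * X ∈ annLie φ eQ aF q := by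
  rw [mem_annLie_iff] at hX hY ⊢
  obtain ⟨hX1, hX2, hX3⟩ := hX
  obtain ⟨hY1, hY2, hY3⟩ := hY
  refine ⟨fun u => ?_, fun i => ?_, fun v w => ?_⟩
  · have h := wordDerAt_commutator_eq_zero ℚ (hX1 u) (hY1 u)
    have hfam : (fun _ : Fin d => LinearMap.toMatrix eQ eQ (X * Y - Y * X)) =
        (fun _ : Fin d => LinearMap.toMatrix eQ eQ X) * (fun _ : Fin d => LinearMap.toMatrix eQ eQ Y) -
        (fun _ : Fin d => LinearMap.toMatrix eQ eQ Y) * fun _ : Fin d => LinearMap.toMatrix eQ eQ X := by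
      funext t
      rw [map_sub, LinearMap.toMatrix_mul, LinearMap.toMatrix_mul]; rfl
    rw [hfam]; exact h
  · calc (X * Y - Y * X) * aF i = X * (Y * aF i) - Y * (X * aF i) := by noncomm_ring
      _ = X * (aF i * Y) - Y * (aF i * X) := by rw [hY2 i, hX2 i]
      _ = (X * aF i) * Y - (Y * aF i) * X := by noncomm_ring
      _ = (aF i * X) * Y - (aF i * Y) * X := by rw [hX2 i, hY2 i]
      _ = aF i * (X * Y - Y * X) := by noncomm_ring
  · simp only [LinearMap.sub_apply, Module.End.mul_apply, map_sub, LinearMap.sub_apply]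
    have h1 := hX3 (Y v) w
    have h2 := hY3 v (X w)
    have h3 := hY3 (X v) w
    have h4 := hX3 v (Y w)
    linear_combination h1 - h3 + h4 - h2

/-- **`Θ ∈ 𝔞_ℂ`**: if the complex conditions vanish on `Θ` — `Θ` kills the complexified tensor, commutes with
the `(aF i)_ℂ` and is `ψ_ℂ`-skew — then `Θ` lies in the complex span of `𝔞` (descent,
`mem_spanC_iInf_ker_of_forall_eq_zero`). [cite: Deligne1982HodgeCycles, I §3 (proof of Prop. 3.4)] -/
theorem mem_spanC_annLie [Module.Finite ℚ V] (φ : LinearMap.BilinForm ℚ V) (eQ : Module.Basis (Fin M) ℚ V)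
    (aF : ιa → Module.End ℚ V) (q : (Fin d → Fin m × Fin M) → ℚ) {Θ : Module.End ℂ (ℂ ⊗[ℚ] V)}
    (h1 : ∀ u : Fin d → Fin m, wordDerAt ℂ (fun _ : Fin d =>
      LinearMap.toMatrix (Algebra.TensorProduct.basis ℂ eQ) (Algebra.TensorProduct.basis ℂ eQ) Θ)
      (wordSlice (fun w => algebraMap ℚ ℂ (q w)) u) = 0)
    (h2 : ∀ i, Θ * (aF i).baseChange ℂ = (aF i).baseChange ℂ * Θ)
    (h3 : ∀ x y, φ.baseChange ℂ (Θ x) y + φ.baseChange ℂ x (Θ y) = 0) :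
    Θ ∈ spanC (annLie φ eQ aF q) := by
  refine mem_spanC_iInf_ker_of_forall_eq_zero (annFamily φ eQ aF q)
    (annFamilyC φ eQ aF fun w => algebraMap ℚ ℂ (q w)) (fun i X => ?_) (fun i => ?_)
  · rcases i with uε | irs | rs
    · exact annCondC_baseChange eQ q uε X
    · exact commCondC_baseChange eQ (aF irs.1) irs.2 X
    · exact skewCondC_baseChange φ eQ rs X
  · rcases i with uε | irs | rs
    · change wordDerAt ℂ (fun _ : Fin d => LinearMap.toMatrix (Algebra.TensorProduct.basis ℂ eQ)
        (Algebra.TensorProduct.basis ℂ eQ) Θ) (wordSlice (fun w => algebraMap ℚ ℂ (q w)) uε.1) uε.2 = 0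
      rw [h1]; rfl
    · change LinearMap.toMatrix (Algebra.TensorProduct.basis ℂ eQ) (Algebra.TensorProduct.basis ℂ eQ)
        (Θ * (aF irs.1).baseChange ℂ - (aF irs.1).baseChange ℂ * Θ) irs.2.1 irs.2.2 = 0
      rw [h2, sub_self, map_zero]; rfl
    · exact h3 _ _

/-- **Every element of `𝔞_ℂ` kills the complexified tensor** (the annihilator condition is linear and
holds on the `X_ℂ`, `X ∈ 𝔞`). [cite: GoodmanWallachGTM255, §4.1.1] -/
theorem wordDerAt_eq_zero_of_mem_spanC_annLie (φ : LinearMap.BilinForm ℚ V) (eQ : Module.Basis (Fin M) ℚ V)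
    (aF : ιa → Module.End ℚ V) (q : (Fin d → Fin m × Fin M) → ℚ) {Y : Module.End ℂ (ℂ ⊗[ℚ] V)}
    (hY : Y ∈ spanC (annLie φ eQ aF q)) (u : Fin d → Fin m) :
    wordDerAt ℂ (fun _ : Fin d =>
      LinearMap.toMatrix (Algebra.TensorProduct.basis ℂ eQ) (Algebra.TensorProduct.basis ℂ eQ) Y)
      (wordSlice (fun w => algebraMap ℚ ℂ (q w)) u) = 0 := by
  funext ε
  have hle : spanC (annLie φ eQ aF q) ≤
      LinearMap.ker (annCondC eQ (fun w => algebraMap ℚ ℂ (q w)) (u, ε)) := by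
    rw [spanC, Submodule.span_le]
    rintro _ ⟨X, hX, rfl⟩
    rw [SetLike.mem_coe, LinearMap.mem_ker, annCondC_baseChange]
    have h := ((mem_annLie_iff φ eQ aF q X).1 hX).1 u
    rw [annCond_apply, h, Pi.zero_apply, map_zero]
  have h := hle hY
  rw [LinearMap.mem_ker, annCondC_apply] at h
  exact h

/-- **Theorem L (invariance of rational tensors under `𝔰𝔭_E(V, ψ)_ℂ = ⊕_i 𝔰𝔩(T_{σ_i})`).** Let `H` be
a polarizable `ℚ`-Hodge structure of odd weight with polarization `ψ` for which `End_Hdg(V) = E` is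
`ψ`-self-adjoint, and let `V_ℂ = ⊕_i T_{σ_i}` be an internal decomposition into two-dimensional
eigenblocks for real characters `σ_i` of `E` (the situation of an abelian variety with real
multiplication by a totally real field of degree `dim`). Let `q` be a rational coefficient tensor
(letters: slots `Fin m` × a `ℚ`-basis `eQ` of `V`) killed — slice by slice, diagonally — by the
matrix of a Hodge operator `Θ` (`= 2p - n` on `V^{p,n-p}`). Then `q` is killed by the matrix of EVERY
block-preserving `ψ_ℂ`-skew operator `Y` of `V_ℂ`. Proof: the rational Lie algebra `𝔞` of `X ∈ 𝔰𝔭_E(V,ψ)`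
killing `q` (`annLie`) is closed under brackets and `Θ ∈ 𝔞_ℂ` by descent (`mem_spanC_annLie`, Deligne
LNM 900 I §3), so `𝔞_ℂ ⊇ ⊕_i 𝔰𝔩(T_{σ_i}) ∋ Y` by the `Θ`-subalgebra theorem
(`ThetaSubalgebra.mem_spanC_of_mapsTo_of_skew`), and `𝔞_ℂ` kills `q_ℂ`. This is the Lie-algebra step
of Ribet's divisoriality theorem for powers (`Hdg = Sp_E` acts on the tensor invariants through
`⊕ 𝔰𝔩₂`). [cite: Ribet1983, Thm. 0–1 (pp. 523–525)] [cite: Deligne1982HodgeCycles, I §3 (proof of Prop. 3.4)]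
[cite: MoonenZarhin1999LowDim, §3 (3.1)] -/
theorem wordDerAt_eq_zero_of_mapsTo_of_skew [Module.Finite ℚ V] [HodgeTensorFacts.{u, u}] {n : ℤ}
    {ι : Type*} [Fintype ι] [DecidableEq ι] (H : HodgeStructure V n) (hn : Odd n) (ψ : H.Polarization)
    (hself : ∀ a : H.endAlg,
      LinearMap.IsAdjointPair ψ.form ψ.form (a : Module.End ℚ V) (a : Module.End ℚ V))
    (σ : ι → (H.endAlg →+* ℂ)) (hreal : ∀ i, (starRingEnd ℂ).comp (σ i) = σ i)
    (hint : DirectSum.IsInternal fun i => H.eigenBlock (σ i))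
    (h2 : ∀ i, Module.finrank ℂ (H.eigenBlock (σ i)) = 2) (eQ : Module.Basis (Fin M) ℚ V)
    (q : (Fin d → Fin m × Fin M) → ℚ) {Θ : Module.End ℂ (ℂ ⊗[ℚ] V)}
    (hΘ : ∀ p, ∀ x ∈ H.piece p (n - p), Θ x = ((2 * p - n : ℤ) : ℂ) • x)
    (hΘq : ∀ u : Fin d → Fin m, wordDerAt ℂ (fun _ : Fin d =>
      LinearMap.toMatrix (Algebra.TensorProduct.basis ℂ eQ) (Algebra.TensorProduct.basis ℂ eQ) Θ)
      (wordSlice (fun w => algebraMap ℚ ℂ (q w)) u) = 0)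
    {Y : Module.End ℂ (ℂ ⊗[ℚ] V)} (hYT : ∀ i, Set.MapsTo Y (H.eigenBlock (σ i)) (H.eigenBlock (σ i)))
    (hYskew : ∀ x y, ψ.form.baseChange ℂ (Y x) y + ψ.form.baseChange ℂ x (Y y) = 0)
    (u : Fin d → Fin m) :
    wordDerAt ℂ (fun _ : Fin d =>
      LinearMap.toMatrix (Algebra.TensorProduct.basis ℂ eQ) (Algebra.TensorProduct.basis ℂ eQ) Y)
      (wordSlice (fun w => algebraMap ℚ ℂ (q w)) u) = 0 := by
  -- the rational Lie algebra `𝔞 ⊆ 𝔰𝔭_E(V, ψ)` of `q`, with `E = End_Hdg(V)` itself as the commuting family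
  set 𝔞 : Submodule ℚ (Module.End ℚ V) := annLie ψ.form eQ (fun a : H.endAlg => (a : Module.End ℚ V)) q
    with h𝔞
  have hΘC : Θ ∈ H.hodgeLieC := H.mem_hodgeLieC_of_forall_piece hΘ
  have hΘ𝔞 : Θ ∈ spanC 𝔞 :=
    mem_spanC_annLie ψ.form eQ _ q hΘq (fun a => commute_baseChange_of_mem_hodgeLieC H hΘC a)
      fun x y => by rw [formBaseChange_skew_of_mem_hodgeLieC ψ hΘC, neg_add_cancel]
  have hbr : ∀ X ∈ 𝔞, ∀ X' ∈ 𝔞, X * X' - X' * X ∈ 𝔞 := fun X hX X' hX' =>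
    commutator_mem_annLie ψ.form eQ _ q hX hX'
  have hcomm : ∀ X ∈ 𝔞, ∀ a : H.endAlg, X * (a : Module.End ℚ V) = (a : Module.End ℚ V) * X :=
    fun X hX a => ((mem_annLie_iff ψ.form eQ _ q X).1 hX).2.1 a
  have hskew : ∀ X ∈ 𝔞, ∀ v w, ψ.form (X v) w + ψ.form v (X w) = 0 :=
    fun X hX => ((mem_annLie_iff ψ.form eQ _ q X).1 hX).2.2
  have hY : Y ∈ spanC 𝔞 :=
    ThetaSubalgebra.mem_spanC_of_mapsTo_of_skew H hn ψ hself σ hreal hint h2 𝔞 hbr hΘ hΘ𝔞 hcomm hskew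
      hYT hYskew
  rw [h𝔞] at hY
  exact wordDerAt_eq_zero_of_mem_spanC_annLie ψ.form eQ _ q hY u

end AnnLie

end HodgeStructure

end Literature.AlgebraicGeometry.Motives

end
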